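import Summits.ResolutionOfSingularities.ResolutionOfSingularities.Theorems.FrobeniusClosingSteerRadicandChainTwo
import Summits.ResolutionOfSingularities.ResolutionOfSingularities.Theorems.FrobeniusClosingSteerRadicandChainAdjoin
import Literature.AlgebraicGeometry.Resolution.LipmanNoEternalNormalisedBranch
import Mathlib.RingTheory.Localization.Integral
import HarnessLib

/-!
# Crux `Steer` (stmt-ResolutionOfSingularities-16345), chain W4.1, σ-residual HIGH, §σ2.25 v2 F-A3 at `c = 2`, part 1/2:
# **the STRIPPED adjoin step is a normalised quadratic transform; F-A3(2) given a normalised realisation** (Theses-free helper)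

OURS (campaign `res-hironaka`, rung L ★L-G4, slot W4.1, chain W4.1, seat `res-D-pv-014` on res-L0-w41-plan-1's RULINGS
30b / 32b / 37b, 2026-08-27; replaces the role of no printed item; NOT a statement of the manuscript under review; AI review is
weaker than expert review).  Part 1 of FILE 2 of the F-A3(2) discharge `NoEternalStrippedRadicandChain p 2 ⟸
Literature.AlgebraicGeometry.Resolution.Lipman1978NoEternalNormalisedBranch` (res-type-038's FILE 1, p518801: Lipman 1978 THEOREM p. 151 +
(1.32)–(1.33) p. 174 / Artin 1986 Thm. (1.1) / Liu 2002 Thm. 8.3.44 followed along one branch WITH normalisation; predicate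
`IsNormalisedQuadraticTransform` = `IsQuadraticTransform` with the chart replaced by its integral closure in `K`).  The leaf
(realisation of the chain in one field) is part 2, `FrobeniusClosingSteerStrippedChainTwoOfLipman.lean`.

## Content (namespace `…Theorems.SwitchingDichotomy.StrippedChainTwo`)

* `isLocalRing_of_integral_le` — a subring `Q ≤ B₁` of a field under a LOCAL `B₁` integral over `Q` is local (units of `Q` = units of
  `B₁` lying in `Q`, by `RadicandChainAdjoin.inv_mem_of_isIntegral`).
* `isNormalisedQuadraticTransform_of_integral` — a local, integrally closed `R₁ ⊇ Q` with fraction field `K`, integral over a quadratic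
  transform `Q` of `R`, is a NORMALISED quadratic transform of `R` (res-L0-w41-plan-1 RULING 37a's (P4) content): with `C = R[𝔪/x]` the
  chart of `Q` and `N` its integral closure in `K`, `N ⊆ R₁`; `Q = C_M` for the elements `M` of `C` invertible in `Q` (an honest
  `IsLocalization M Q`), so integrality over `Q` clears to integrality over `C` (Mathlib `IsIntegral.exists_multiple_integral_of_isLocalization`)
  and every `z ∈ R₁` is `(m z)/m` with `m z, m ∈ N`, `m⁻¹ ∈ Q ⊆ R₁`; domination by `inv_mem_of_isIntegral`.
* `isNormalisedQuadraticTransform_adjoin` — **the adjoin step, normalised** (res-L0-w41-strat-2's NORMALISATION READING 2026-08-27T09:07:40Z):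
  for a quadratic transform `A → A₁` with `𝔪_A · A₁ = (x₁)` and torsor generators `θ₀^p = f₀ ∈ A`, `θ₁^p = f₁ ∈ A₁` obeying the
  STRIPPED law `θ₀ = x₁^(n+1) θ₁ + g`, the step `B = A[θ₀] → B₁ = A₁[θ₁]` (`B₁` local, integrally closed, fraction field `K`) is a
  normalised quadratic transform: `Q := A₁[x₁^n θ₁]` is a quadratic transform of `B` by K(2)'s adjoin step
  `RadicandChainAdjoin.isQuadraticTransform_adjoin` VERBATIM (radicand `x₁^(pn) f₁`, law `θ₀ = x₁ · (x₁^n θ₁) + g`), local, and `B₁`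
  is integral over `Q ⊇ A₁` — the `n` strippings are swallowed by the normalisation.
* `false_of_normalisedRealisation` — K(2)'s `RadicandChainTwo.false_of_realisation` with `IsQuadraticTransform` ↦
  `IsNormalisedQuadraticTransform` and `Lipman1978NoEternalNormalBranch` ↦ `Lipman1978NoEternalNormalisedBranch`: a realised chain with
  normal (isolated — `RadicandChainTwo.isIntegrallyClosed_of_isolated`) two-dimensional members has a regular member, contradicting the
  cleaned multiplicity (`RadicandChainTwo.not_isRegularLocalRing_of_sub_pow_mem_sq`).

[cite: Lipman1978, Thm. p. 151, (1.32)–(1.33) p. 174] [cite: Artin1986, Thm. (1.1)] [cite: Cutkosky2014, §2.1] [folklore]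
-/

noncomputable section

-- `Summit.<S>.<S>.…` duplicates the summit name by design (single-problem summit).
set_option linter.dupNamespace false

open Polynomial IsLocalRing

namespace Summit.ResolutionOfSingularities.ResolutionOfSingularities.Theorems.SwitchingDichotomy

open Literature.AlgebraicGeometry.Resolution

namespace StrippedChainTwo

universe u

/-! ## The adjoin step, normalised: `A[θ₀] → A₁[θ₁]` with `θ₀ = x₁^(n+1) θ₁ + g` is a normalised quadratic transform -/

section Adjoin

variable {K : Type u} [Field K]

/-- A local subring `B₁ ⊆ K` INTEGRAL over a subring `Q ≤ B₁` makes `Q` local: a non-unit of `Q` is a non-unit of `B₁` (if `a⁻¹ ∈ B₁`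
then `a⁻¹`, being integral over `Q ∋ a`, lies in `Q` — `RadicandChainAdjoin.inv_mem_of_isIntegral`), and non-units of the local `B₁`
are closed under addition. [folklore] -/
theorem isLocalRing_of_integral_le {Q B₁ : Subring K} [IsLocalRing B₁] (hQB₁ : Q ≤ B₁)
    (hint : ∀ z ∈ B₁, IsIntegral Q z) : IsLocalRing Q := by
  have hnu : ∀ a : Q, a ∈ nonunits Q → (Subring.inclusion hQB₁ a) ∈ nonunits B₁ := by
    intro a ha hu
    apply ha
    rw [isUnit_subring_iff_inv_mem] at hu ⊢
    refine ⟨hu.1, RadicandChainAdjoin.inv_mem_of_isIntegral Q a.2 (hint _ hu.2)⟩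
  refine IsLocalRing.of_nonunits_add fun a b ha hb hab => ?_
  have h := IsLocalRing.nonunits_add (hnu a ha) (hnu b hb)
  rw [← map_add] at h
  exact h (hab.map (Subring.inclusion hQB₁))

/-- **A local, integrally closed, integral extension `R₁` (with fraction field `K`) of a quadratic transform `Q` of `R` is a
normalised quadratic transform of `R`.**  With `C = R[𝔪/x]` the chart of `Q` and `N` the integral closure of `C` in `K`:
`N ⊆ R₁` (`R₁` is integrally closed in `K` and contains `C`); `Q = C_M` for the submonoid `M` of elements of `C` invertible in
`Q`, so every `z ∈ R₁`, integral over `Q`, has `m·z` integral over `C` for some `m ∈ M` (Mathlib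
`IsIntegral.exists_multiple_integral_of_isLocalization`), i.e. `z = (m z)/m` with `m z, m ∈ N`, `m⁻¹ ∈ Q ⊆ R₁`; and `R₁`
dominates `R` (a unit of `R₁` from `R` has its inverse integral over `Q ∋` it, hence in `Q`, hence in `R`). [folklore] -/
theorem isNormalisedQuadraticTransform_of_integral {R Q R₁ : Subring K}
    (hQ : IsQuadraticTransform R Q) (hQR₁ : Q ≤ R₁) [hloc : IsLocalRing R₁] (hint : ∀ z ∈ R₁, IsIntegral Q z)
    (hic : IsIntegrallyClosed R₁) (hfrac : ∀ z : K, ∃ a ∈ R₁, ∃ b ∈ R₁, b ≠ 0 ∧ z = a / b) :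
    IsNormalisedQuadraticTransform R R₁ := by
  obtain ⟨hRloc, x, hx, hx0, hQloc, hCQ, hQfrac, hdom⟩ := hQ
  haveI := hRloc
  haveI := hQloc
  set C : Subring K := blowupRing R (x : K) with hC
  have hCR₁ : C ≤ R₁ := hCQ.trans hQR₁
  haveI : IsFractionRing R₁ K := IsFractionRing.of_field R₁ K fun z => by
    obtain ⟨a, ha, b, hb, -, rfl⟩ := hfrac z
    exact ⟨⟨a, ha⟩, ⟨b, hb⟩, rfl⟩
  -- ### `N ⊆ R₁`
  have hN : (integralClosure C K).toSubring ≤ R₁ := by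
    intro z hz
    have hz' : IsIntegral C z := hz
    letI : Algebra C R₁ := (Subring.inclusion hCR₁).toAlgebra
    haveI : IsScalarTower C R₁ K := IsScalarTower.of_algebraMap_eq fun _ => rfl
    obtain ⟨y, hy⟩ := (isIntegrallyClosed_iff K).mp hic hz'.tower_top
    rw [← hy]
    exact y.2
  -- ### `Q = C_M`, `M` = the elements of `C` invertible in `Q`
  letI algCQ : Algebra C Q := (Subring.inclusion hCQ).toAlgebra
  haveI : IsScalarTower C Q K := IsScalarTower.of_algebraMap_eq fun _ => rfl
  let M : Submonoid C := (IsUnit.submonoid Q).comap (Subring.inclusion hCQ)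
  have hMmem : ∀ c : C, c ∈ M ↔ IsUnit (Subring.inclusion hCQ c) := fun c => Iff.rfl
  haveI : IsLocalization M Q := by
    refine ⟨fun m => (hMmem m.1).mp m.2, fun z => ?_, fun {a b} h => ⟨1, ?_⟩⟩
    · obtain ⟨a, ha, b, hb, hbinv, hz⟩ := hQfrac z z.2
      rcases eq_or_ne b 0 with rfl | hb0
      · refine ⟨(0, 1), ?_⟩
        have : (z : K) = 0 := by rw [hz, div_zero]
        have hz0 : z = 0 := Subtype.ext this
        simp [hz0]
      · have hbu : IsUnit (Subring.inclusion hCQ ⟨b, hb⟩) :=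
          (isUnit_subring_iff_inv_mem _).mpr ⟨hb0, hbinv⟩
        refine ⟨(⟨a, ha⟩, ⟨⟨b, hb⟩, (hMmem _).mpr hbu⟩), Subtype.ext ?_⟩
        show (z : K) * b = a
        rw [hz, div_mul_cancel₀ a hb0]
    · have h' : ((Subring.inclusion hCQ a : Q) : K) = (Subring.inclusion hCQ b : K) := congrArg Subtype.val h
      have hab : a = b := Subtype.ext h'
      rw [hab]
  -- ### the fraction clause
  have hfr : ∀ z ∈ R₁, ∃ a ∈ (integralClosure C K).toSubring, ∃ b ∈ (integralClosure C K).toSubring,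
      b⁻¹ ∈ R₁ ∧ z = a / b := by
    intro z hz
    obtain ⟨⟨m, hm⟩, hmz⟩ := IsIntegral.exists_multiple_integral_of_isLocalization M z (hint z hz)
    have hmu : IsUnit (Subring.inclusion hCQ m) := (hMmem m).mp hm
    obtain ⟨hm0, hminv⟩ := (isUnit_subring_iff_inv_mem _).mp hmu
    refine ⟨(m : K) * z, ?_, (m : K), ?_, hQR₁ hminv, ?_⟩
    · have : (⟨m, hm⟩ : M) • z = (m : K) * z := by
        show (m : C) • z = (m : K) * z
        rw [Algebra.smul_def]
        rfl
      rw [← this]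
      exact hmz
    · exact isIntegral_algebraMap (R := C) (x := m)
    · exact (mul_div_cancel_left₀ z hm0).symm
  -- ### domination
  have hdom' : SubringDominates R R₁ := by
    refine ⟨hdom.1.trans hQR₁, fun y hy hyinv => ?_⟩
    have hyQ : y ∈ Q := hdom.1 hy
    exact hdom.2 y hy (RadicandChainAdjoin.inv_mem_of_isIntegral Q hyQ (hint _ hyinv))
  exact ⟨hRloc, x, hx, hx0, hloc, hN, hfr, hdom'⟩

/-- **The adjoin step, normalised.** Let `A → A₁` be a quadratic transform of local subrings of `K` with `𝔪_A · A₁ = (x₁)`, and let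
`θ₀, θ₁ ∈ K` with `θ₀^p = f₀ ∈ A`, `θ₁^p = f₁ ∈ A₁` (`p ≠ 0`) and the STRIPPED strict-transform law `θ₀ = x₁^(n+1) θ₁ + g`, `g ∈ A`.
If `B = A[θ₀]` and `B₁ = A₁[θ₁]` are local, `B₁` is integrally closed and `K` is its field of fractions, then `B → B₁` is a
NORMALISED quadratic transform: `Q := A₁[x₁^n θ₁]` is a quadratic transform of `B` (the adjoin step of K(2),
`RadicandChainAdjoin.isQuadraticTransform_adjoin`, for the radicand `x₁^(pn) f₁` and the law `θ₀ = x₁ · (x₁^n θ₁) + g`), local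
(`isLocalRing_of_integral_le`), and `B₁ ⊇ Q` is integral over `Q ⊇ A₁` (it is integral over `A₁`), so
`isNormalisedQuadraticTransform_of_integral` applies. [cite: Cutkosky2014, §2.1]
[cite: Lipman1978, (1.32) p. 174] [folklore] -/
theorem isNormalisedQuadraticTransform_adjoin {A A₁ B B₁ : Subring K}
    [IsLocalRing A] [IsLocalRing A₁] [IsLocalRing B] [IsLocalRing B₁]
    (hAQ : IsQuadraticTransform A A₁) (hle : A ≤ A₁)
    {p : ℕ} (hp : p ≠ 0) {θ₀ θ₁ : K} (f₀ g : A) (f₁ x₁ : A₁) (n : ℕ)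
    (hθ₀ : θ₀ ^ p = (f₀ : K)) (hθ₁ : θ₁ ^ p = (f₁ : K)) (hrel : θ₀ = (x₁ : K) ^ (n + 1) * θ₁ + (g : K))
    (hspan : Ideal.span ((fun y : A => (⟨(y : K), hle y.2⟩ : A₁)) '' (maximalIdeal A : Set A)) =
      Ideal.span {x₁})
    (hB : B = Subring.closure ((A : Set K) ∪ {θ₀}))
    (hB₁ : B₁ = Subring.closure ((A₁ : Set K) ∪ {θ₁}))
    (hB₁ic : IsIntegrallyClosed B₁) (hB₁frac : ∀ z : K, ∃ a ∈ B₁, ∃ b ∈ B₁, b ≠ 0 ∧ z = a / b) :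
    IsNormalisedQuadraticTransform B B₁ := by
  -- ### the intermediate generator `θ' = x₁^n θ₁`, radicand `x₁^(p n) f₁ ∈ A₁`
  set θ' : K := (x₁ : K) ^ n * θ₁ with hθ'
  have hθ'pow : θ' ^ p = ((x₁ ^ (p * n) * f₁ : A₁) : K) := by
    rw [hθ', mul_pow, ← pow_mul, hθ₁, Subring.coe_mul, Subring.coe_pow, mul_comm n p]
  have hrel' : θ₀ = (x₁ : K) * θ' + (g : K) := by
    rw [hrel, hθ', pow_succ', mul_assoc]
  set Q : Subring K := Subring.closure ((A₁ : Set K) ∪ {θ'}) with hQ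
  -- ### inclusions
  have hA₁B₁ : A₁ ≤ B₁ := by
    rw [hB₁]; exact fun z hz => Subring.subset_closure (Or.inl hz)
  have hθ₁B₁ : θ₁ ∈ B₁ := by
    rw [hB₁]; exact Subring.subset_closure (Or.inr rfl)
  have hA₁Q : A₁ ≤ Q := fun z hz => Subring.subset_closure (Or.inl hz)
  have hQB₁ : Q ≤ B₁ := by
    refine Subring.closure_le.mpr ?_
    rintro z (hz | hz)
    · exact hA₁B₁ hz
    · rw [Set.mem_singleton_iff] at hz
      rw [hz, hθ']
      exact B₁.mul_mem (B₁.pow_mem (hA₁B₁ x₁.2) n) hθ₁B₁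
  -- ### `B₁` is integral over `A₁`, hence over `Q`
  have hintA₁ : ∀ c ∈ B₁, IsIntegral A₁ c := fun c hc =>
    RadicandChainAdjoin.isIntegral_of_mem_closure A₁ hp f₁ hθ₁ (hB₁ ▸ hc)
  have hintQ : ∀ c ∈ B₁, IsIntegral Q c := by
    intro c hc
    letI : Algebra A₁ Q := (Subring.inclusion hA₁Q).toAlgebra
    haveI : IsScalarTower A₁ Q K := IsScalarTower.of_algebraMap_eq fun _ => rfl
    exact (hintA₁ c hc).tower_top
  -- ### `Q` is local and a quadratic transform of `B`
  haveI : IsLocalRing Q := isLocalRing_of_integral_le hQB₁ hintQ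
  have hQT : IsQuadraticTransform B Q :=
    RadicandChainAdjoin.isQuadraticTransform_adjoin hAQ hle hp f₀ g (x₁ ^ (p * n) * f₁) x₁ hθ₀ hθ'pow hrel'
      hspan hB hQ
  exact isNormalisedQuadraticTransform_of_integral hQT hQB₁ hintQ hB₁ic hB₁frac

end Adjoin

/-! ## F-A3(2) given a normalised realisation -/

section Assembly

/-- **F-A3(2) given a realisation as a normalised branch.** Let `S m ⊆ L` (`char L = p`) be regular local rings of dimension two
carrying radicands `f m` of cleaned multiplicity `p` (`f m − h^p ∈ 𝔪^p`) whose torsor germs `T m = (S m)[X]/(X^p − f m)` have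
isolated singularity.  If the `T m` are realised (`T m ≃+* R m`) as a sequence `R : ℕ → Subring K′` of subrings of a field with `R 0`
a Noetherian excellent local ring of `K′`, every `R (m+1)` a NORMALISED quadratic transform of `R m` and every `R m` of dimension two,
then — `T m`, hence `R m`, being integrally closed (`RadicandChainTwo.isIntegrallyClosed_of_isolated`) — Lipman's normalised-branch
fact `Lipman1978NoEternalNormalisedBranch` yields a REGULAR `R m`, contradicting `RadicandChainTwo.not_isRegularLocalRing_of_sub_pow_mem_sq`
(`𝔪^p ⊆ 𝔪²`).  Conditional on the named fact (hypothesis `hL`). [cite: Lipman1978, Thm. p. 151, (1.32)–(1.33) p. 174]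
[cite: Artin1986, Thm. (1.1)] [folklore] -/
theorem false_of_normalisedRealisation (hL : Lipman1978NoEternalNormalisedBranch.{0}) {p : ℕ} [Fact p.Prime]
    {L : Type} [Field L] [CharP L p] (S : ℕ → Subring L) (f : ∀ m, S m)
    (hreg : ∀ m, IsRegularLocalRing (S m)) (hdim : ∀ m, ringKrullDim (S m) = (2 : ℕ))
    (hmult : ∀ m, ∃ h : S m, f m - h ^ p ∈ maximalIdeal (S m) ^ p)
    (hisol : ∀ m, ∀ (P : Ideal (AdjoinRoot ((X : (S m)[X]) ^ p - C (f m)))) [P.IsPrime],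
      (∃ Q : Ideal (AdjoinRoot ((X : (S m)[X]) ^ p - C (f m))), Q.IsPrime ∧ P < Q) →
      IsRegularLocalRing (Localization.AtPrime P))
    {K' : Type} [Field K'] (R : ℕ → Subring K')
    (e : ∀ m, AdjoinRoot ((X : (S m)[X]) ^ p - C (f m)) ≃+* R m)
    (hR0 : IsLocalRingOf (R 0)) (hN0 : IsNoetherianRing (R 0)) (hE0 : IsExcellentRing (R 0))
    (hNT : ∀ m, IsNormalisedQuadraticTransform (R m) (R (m + 1))) (hdimR : ∀ m, ringKrullDim (R m) = (2 : ℕ)) :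
    False := by
  have hnorm : ∀ m, IsIntegrallyClosed (R m) := fun m =>
    haveI := hreg m
    haveI : IsIntegrallyClosed (AdjoinRoot ((X : (S m)[X]) ^ p - C (f m))) :=
      RadicandChainTwo.isIntegrallyClosed_of_isolated p (f m) (hdim m) (hisol m)
    IsIntegrallyClosed.of_equiv (e m)
  obtain ⟨m, hm⟩ := hL K' R hR0 hN0 hE0 hNT hnorm (fun m => by rw [hdimR m, Nat.cast_ofNat])
  haveI := hreg m
  have hT : IsRegularLocalRing (AdjoinRoot ((X : (S m)[X]) ^ p - C (f m))) :=
    haveI := hm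
    IsRegularLocalRing.of_ringEquiv (e m).symm
  obtain ⟨h, hh⟩ := hmult m
  exact RadicandChainTwo.not_isRegularLocalRing_of_sub_pow_mem_sq p
    (Ideal.pow_le_pow_right (Fact.out : p.Prime).two_le hh) hT

end Assembly

end StrippedChainTwo

end Summit.ResolutionOfSingularities.ResolutionOfSingularities.Theorems.SwitchingDichotomy

end
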